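import Summits.CriticalPhenomena.PercolationContinuityZ3.Theorems.PercNearOneGluingNoHeavyLowerTailKNGoodSeries
import HarnessLib

/-!
# The series step for Kozma–Nitzan GOODNESS — the unconditional case: the loneliest relay of `G − o` is no lonelier than a child
# (`NoHeavyLowerTail` cell, stmt-CriticalPhenomena-4575; prover `prim-hp-2`, deletion–contraction line, gen 3)

Support file (`--supports stmt-CriticalPhenomena-4575`).  No definitions, no named facts, no sorries.
`KNGoodSeries.knGood_series_of_gluing` reduces goodness at an observer `o` with two Steiner neighbours `x, y` to goodness of `x` and
`y` in `G − o` plus the gluing inequality GC.  GC is a theorem whenever the minimiser `a₀` of `P_{G−o}(· ↔ b)` is no lonelier in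
`G − o` than `y` (or than `x`): the in-graph gluing transfer `KNGoodHair.glueTransfer_openConn` gives
`P_{(G−o)+xy}(a₀ ↔ b) ≤ P_{(G−o)+xy}(x ↔ b)` and the pocket term is `≥ 0`.

* `KNGoodSeriesEasy.knGood_series_of_notLonelier` — `o ∉ A` with positive pairs only to `x ≠ y`; `(G−o, A, x, b)`, `(G−o, A, y, b)` good;
  `P_{G−o}(a₀ ↔ b) ≤ P_{G−o}(y ↔ b)` for the minimiser `a₀` ⇒ `(G, A, o, b)` good.  (For the `x`-version swap `x` and `y`.)
* `KNGoodSeriesEasy.knGood_twoStars_hairs_of_notLonelier` — **Kozma–Nitzan goodness (hence their (2) and Conjecture 1, `KNGood.preFKG2`)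
  for an observer with relay hairs and TWO pendant relay-stars `x, y`, whenever the loneliest relay of `G − o` is no lonelier there than
  one of the stars.**  (Theorem 4 for `x`, `y` in `G − o`; the series step; hairs by `KNGoodHair.knGood_of_deleteHairs`.)  Kozma–Nitzan's
  Theorem 5 is one star; prim-hp-2 gen 2 (`KNConjOne.knConj1_twoPendantStars`) is two stars WITHOUT hairs and only Conjecture 1; the case
  left open here — both stars lonelier in `G − o` than every relay — is exactly the hard case of GC (seat notes).
-/

noncomputable section

namespace Summit.CriticalPhenomena.PercolationContinuityZ3.Theorems

open MeasureTheory Set Literature.Probability.LatticeModels Literature.Probability.Percolation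
open scoped Classical BigOperators

variable {n : ℕ}

namespace KNGoodSeriesEasy

open ChampionStability KNGoodAux KNGoodHair RelayNbhd CILTwoSteiner KNGoodSeries

/-- **Series step for goodness when the loneliest relay of `G − o` is no lonelier than `y`.**  `o ∉ A` with positive pairs only to
`x ≠ y` (both `≠ o`), `b ≠ o`, `a₀ ∈ A` minimising `P_{G−o}(· ↔ b)` with `P_{G−o}(a₀ ↔ b) ≤ P_{G−o}(y ↔ b)`; if `(G−o, A, x, b)` and
`(G−o, A, y, b)` are good then `(G, A, o, b)` is good (`G − o = pinW w {pairs at o} ∅`).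
[cite: KozmaNitzan2024, Thm. 5 (pp. 13–14) — extension; VandenbergHaggstromKahn2005, Thm. 1.5 (p. 7)] -/
theorem knGood_series_of_notLonelier (w : Sym2 (Fin n) → unitInterval) (A : Finset (Fin n)) (hA : A.Nonempty)
    (o x y a₀ b : Fin n) (ho : o ∉ A) (hxo : x ≠ o) (hyo : y ≠ o) (hxy : x ≠ y) (ha₀ : a₀ ∈ A) (hbo : b ≠ o)
    (hiso : ∀ v : Fin n, v ≠ o → v ≠ x → v ≠ y → (w s(o, v) : ℝ) = 0)
    (hmin : ∀ a' ∈ A, (prodBernoulli (pinW w {e : Sym2 (Fin n) | o ∈ e ∧ ¬ e.IsDiag} ∅)).real (openConn a₀ b) ≤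
      (prodBernoulli (pinW w {e : Sym2 (Fin n) | o ∈ e ∧ ¬ e.IsDiag} ∅)).real (openConn a' b))
    (hgoodx : KNGood (pinW w {e : Sym2 (Fin n) | o ∈ e ∧ ¬ e.IsDiag} ∅) A hA x b)
    (hgoody : KNGood (pinW w {e : Sym2 (Fin n) | o ∈ e ∧ ¬ e.IsDiag} ∅) A hA y b)
    (hy : (prodBernoulli (pinW w {e : Sym2 (Fin n) | o ∈ e ∧ ¬ e.IsDiag} ∅)).real (openConn a₀ b) ≤
      (prodBernoulli (pinW w {e : Sym2 (Fin n) | o ∈ e ∧ ¬ e.IsDiag} ∅)).real (openConn y b)) :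
    KNGood w A hA o b := by
  refine knGood_series_of_gluing w A hA o x y a₀ b ho hxo hyo hxy ha₀ hbo hiso hmin hgoodx hgoody ?_
  have hglue := glueTransfer_openConn (pinW w {e : Sym2 (Fin n) | o ∈ e ∧ ¬ e.IsDiag} ∅) x y a₀ b hxy hy
  have hD : 0 ≤ ∑ W ∈ nullSets A,
      (prodBernoulli (Function.update (pinW w {e : Sym2 (Fin n) | o ∈ e ∧ ¬ e.IsDiag} ∅) s(x, y) 1)).real (clusterIs x W) *
        A.inf' hA (fun a' => (prodBernoulli (Function.update (pinW w {e : Sym2 (Fin n) | o ∈ e ∧ ¬ e.IsDiag} ∅) s(x, y) 1)).real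
          (openConnIn ((↑W : Set (Fin n))ᶜ) a' b)) := by
    refine Finset.sum_nonneg fun W _ => mul_nonneg measureReal_nonneg ?_
    exact (Finset.le_inf'_iff hA _).2 fun a _ => measureReal_nonneg
  linarith

/-- `pinW` at the star of `o` ignores the weights of the pairs at `o`. [folklore] -/
theorem pinW_star_eq_of_eqOff (w w' : Sym2 (Fin n) → unitInterval) (o : Fin n)
    (h : ∀ e : Sym2 (Fin n), ¬ (o ∈ e ∧ ¬ e.IsDiag) → w' e = w e) :
    pinW w' {e : Sym2 (Fin n) | o ∈ e ∧ ¬ e.IsDiag} ∅ = pinW w {e : Sym2 (Fin n) | o ∈ e ∧ ¬ e.IsDiag} ∅ := by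
  funext e
  by_cases hmem : e ∈ {e : Sym2 (Fin n) | o ∈ e ∧ ¬ e.IsDiag}
  · obtain ⟨hoe, hdiag⟩ := hmem
    obtain ⟨v, rfl⟩ : ∃ v, e = s(o, v) := by
      induction e using Sym2.ind with
      | h a b =>
        rcases Sym2.mem_iff.1 hoe with rfl | rfl
        · exact ⟨b, rfl⟩
        · exact ⟨a, Sym2.eq_swap⟩
    have hvo : v ≠ o := by
      intro hv; apply hdiag; rw [hv]; exact Sym2.mk_isDiag_iff.2 rfl
    rw [pinW_star_mk w' hvo, pinW_star_mk w hvo]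
  · rw [pinW_apply_of_not_mem w' ∅ hmem, pinW_apply_of_not_mem w ∅ hmem]
    exact h e hmem

/-- **Goodness for an observer with relay hairs and two pendant relay-stars, when the loneliest relay of `G − o` is no lonelier
than one of the stars.**  `o ∉ A`; `x ≠ y` not in `A`, `≠ o`, not adjacent; positive pairs at `o` go into `A ∪ {x, y}`, at `x` into
`A ∪ {o}`, at `y` into `A ∪ {o}`; `b ≠ o`; `a₀ ∈ A` minimises `P_{G−o}(· ↔ b)` and `P_{G−o}(a₀ ↔ b) ≤ P_{G−o}(y ↔ b)`.  Then
`(G, A, o, b)` is good; in particular `P(o ↔ b) ≥ P(o ↔ A, a ↔ b)` for some `a ∈ A` (`KNGood.preFKG2`) and Conjecture 1 holds at `o`.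
[cite: KozmaNitzan2024, Thm. 4 (p. 12), Thm. 5 (p. 13), Conjecture 1 (p. 3) — extension] -/
theorem knGood_twoStars_hairs_of_notLonelier (w : Sym2 (Fin n) → unitInterval) (A : Finset (Fin n)) (hA : A.Nonempty)
    (o x y a₀ b : Fin n) (ho : o ∉ A) (hx : x ∉ A) (hy' : y ∉ A) (hxo : x ≠ o) (hyo : y ≠ o) (hxy : x ≠ y) (ha₀ : a₀ ∈ A)
    (hbo : b ≠ o) (hxyw : w s(x, y) = 0)
    (hoN : ∀ v : Fin n, v ≠ o → v ∉ A → v ≠ x → v ≠ y → w s(o, v) = 0)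
    (hxN : ∀ u : Fin n, u ≠ x → u ∉ A → u ≠ o → w s(x, u) = 0)
    (hyN : ∀ u : Fin n, u ≠ y → u ∉ A → u ≠ o → w s(y, u) = 0)
    (hmin : ∀ a' ∈ A, (prodBernoulli (pinW w {e : Sym2 (Fin n) | o ∈ e ∧ ¬ e.IsDiag} ∅)).real (openConn a₀ b) ≤
      (prodBernoulli (pinW w {e : Sym2 (Fin n) | o ∈ e ∧ ¬ e.IsDiag} ∅)).real (openConn a' b))
    (hy : (prodBernoulli (pinW w {e : Sym2 (Fin n) | o ∈ e ∧ ¬ e.IsDiag} ∅)).real (openConn a₀ b) ≤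
      (prodBernoulli (pinW w {e : Sym2 (Fin n) | o ∈ e ∧ ¬ e.IsDiag} ∅)).real (openConn y b)) :
    KNGood w A hA o b := by
  -- delete the hairs at `o`
  set w' : Sym2 (Fin n) → unitInterval := fun e => if ∃ p ∈ A, e = s(o, p) then 0 else w e with hw'
  refine knGood_of_deleteHairs w A hA o b ho ?_
  rw [← hw']
  -- `G' − o = G − o`
  have hpin : pinW w' {e : Sym2 (Fin n) | o ∈ e ∧ ¬ e.IsDiag} ∅ = pinW w {e : Sym2 (Fin n) | o ∈ e ∧ ¬ e.IsDiag} ∅ := by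
    refine pinW_star_eq_of_eqOff w w' o fun e he => ?_
    rw [hw']; simp only
    rw [if_neg]
    rintro ⟨p, hp, rfl⟩
    exact he ⟨Sym2.mem_mk_left o p, fun hd => ho ((Sym2.mk_isDiag_iff.1 hd) ▸ hp)⟩
  set w0 := pinW w {e : Sym2 (Fin n) | o ∈ e ∧ ¬ e.IsDiag} ∅ with hw0
  -- Theorem 4 for the pendant stars `x`, `y` of `G − o`
  have hw0off : ∀ u v : Fin n, u ≠ o → v ≠ o → w0 s(u, v) = w s(u, v) := by
    intro u v hu hv
    have hmem : s(u, v) ∉ {e : Sym2 (Fin n) | o ∈ e ∧ ¬ e.IsDiag} := by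
      rintro ⟨hoe, -⟩
      rcases Sym2.mem_iff.1 hoe with h | h
      · exact hu h.symm
      · exact hv h.symm
    rw [hw0, pinW_apply_of_not_mem w ∅ hmem]
  have hgoodx : KNGood w0 A hA x b := by
    refine KozmaNitzan2024_thm4_good w0 A hA x b hx fun u hux huA => ?_
    by_cases huo : u = o
    · rw [huo, Sym2.eq_swap, hw0]; exact pinW_star_mk w hxo
    · by_cases huy : u = y
      · rw [huy, hw0off x y hxo hyo]; exact hxyw
      · rw [hw0off x u hxo huo]; exact hxN u hux huA huo
  have hgoody : KNGood w0 A hA y b := by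
    refine KozmaNitzan2024_thm4_good w0 A hA y b hy' fun u huy huA => ?_
    by_cases huo : u = o
    · rw [huo, Sym2.eq_swap, hw0]; exact pinW_star_mk w hyo
    · by_cases hux : u = x
      · rw [hux, Sym2.eq_swap, hw0off x y hxo hyo]; exact hxyw
      · rw [hw0off y u hyo huo]; exact hyN u huy huA huo
  refine knGood_series_of_notLonelier w' A hA o x y a₀ b ho hxo hyo hxy ha₀ hbo ?_ (by rw [hpin]; exact hmin)
    (by rw [hpin]; exact hgoodx) (by rw [hpin]; exact hgoody) (by rw [hpin]; exact hy)
  intro v hvo hvx hvy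
  rw [hw']; simp only
  by_cases hvA : v ∈ A
  · rw [if_pos ⟨v, hvA, rfl⟩]; rfl
  · rw [if_neg]
    · exact congrArg Subtype.val (hoN v hvo hvA hvx hvy)
    · rintro ⟨p, hp, hvp⟩
      exact hvA ((Sym2.congr_right.1 hvp) ▸ hp)

end KNGoodSeriesEasy

end Summit.CriticalPhenomena.PercolationContinuityZ3.Theorems

end
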